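import Mathlib

/-!
# The multiquadratic order `ℤ[√ℓ_S : S ⊆ ι]` in explicit coordinates (wall-breaker axis `parabola lifts over finite
fields`, stub `stub_tangencySets` of the crux `LevelOneGL2Designs`, stmt-MatrixMultiplication-14080 — all-primes
trace-zero lift, file 2)

For a family of naturals `ℓ : ι → ℕ` put `ℓ_S = ∏_{i∈S} ℓ_i`.  In `K = ℚ(√ℓ_i : i ∈ ι)` one has
`√ℓ_S · √ℓ_T = ℓ_{S∩T} · √ℓ_{S∆T}`, so the `ℤ`-span of the `√ℓ_S` is an order with the explicit product

  `(z ⋆ u)_U = Σ_S z_S · u_{S∆U} · ℓ_{S∖U}`   (coordinates `z, u : Finset ι → ℤ`).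

We never build this ring as a type: everything the lift needs is the behaviour of the product under the two
EVALUATION maps `E_t(c) = Σ_S c_S · ∏_{i∈S} t_i` into a commutative ring `R` carrying square roots `t_i² = ℓ_i`
(`R = ℝ`, `t_i = √ℓ_i`: the real embedding; `R` a field of characteristic `q`, `t_i² = ℓ_i`: the reduction):

* `prod_root_mul` — `(∏_S t)(∏_T t) = ℓ_{S∩T} · ∏_{S∆T} t`;
* `eval_star` — `E_t(z) · E_t(u) = E_t(z ⋆ u)` (both evaluations are multiplicative for `⋆`);
* `eval_sub`, `star_sub_left/right`-free bookkeeping: `E_t` is additive;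
* `star_self_empty`, `star_self_empty_pos` — the TRACE functional `c ↦ c_∅` (`= 2^{-|ι|} Tr_{K/ℚ}`) satisfies
  `(z ⋆ z)_∅ = Σ_S z_S² ℓ_S > 0` for `z ≠ 0`: the trace form is positive definite, read off the coordinates — the
  multiquadratic substitute for `Tr(z²) = Σ_σ σ(z)² > 0` of a totally real field (Pohoata 2026, Obs. 3.1);
* `star_support` — if `z, u` are supported on a set `𝒮` of index sets closed under `∆`, so is `z ⋆ u`, and
  `z ⋆ u` vanishes identically off `𝒮`.

Elementary finite sums; no definitions (the product is written out in each statement).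
-/

-- the summit/problem path `MatrixMultiplication.MatrixMultiplication` is fixed by the tree layout (D-0017)
set_option linter.dupNamespace false

noncomputable section

open Finset

namespace Summit.MatrixMultiplication.MatrixMultiplication.Theorems.LevelOneGL2Designs.Multiquadratic

variable {ι : Type*} [Fintype ι] [DecidableEq ι] (ℓ : ι → ℕ) {R : Type*} [CommRing R] (t : ι → R)

omit [Fintype ι] in
/-- **Multiplication table of the square roots**: if `t_i² = ℓ_i` then
`(∏_{i∈S} t_i)(∏_{i∈T} t_i) = (∏_{i∈S∩T} ℓ_i) · ∏_{i∈S∆T} t_i`. [elementary] -/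
theorem prod_root_mul (ht : ∀ i, t i ^ 2 = (ℓ i : R)) (S T : Finset ι) :
    (∏ i ∈ S, t i) * (∏ i ∈ T, t i) = (∏ i ∈ S ∩ T, (ℓ i : R)) * ∏ i ∈ symmDiff S T, t i := by
  have hU : S ∪ T = symmDiff S T ∪ S ∩ T := by
    ext p; simp only [Finset.mem_union, Finset.mem_symmDiff, Finset.mem_inter]; tauto
  have hd : Disjoint (symmDiff S T) (S ∩ T) := by
    rw [Finset.disjoint_left]; intro p hp hp'
    rw [Finset.mem_symmDiff] at hp; rw [Finset.mem_inter] at hp'; tauto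
  rw [← Finset.prod_union_inter, hU, Finset.prod_union hd]
  have hsq : (∏ i ∈ S ∩ T, t i) * (∏ i ∈ S ∩ T, t i) = ∏ i ∈ S ∩ T, (ℓ i : R) := by
    rw [← Finset.prod_mul_distrib]
    exact Finset.prod_congr rfl fun i _ => by rw [← sq, ht i]
  calc (∏ i ∈ symmDiff S T, t i) * (∏ i ∈ S ∩ T, t i) * ∏ i ∈ S ∩ T, t i
      = (∏ i ∈ symmDiff S T, t i) * ((∏ i ∈ S ∩ T, t i) * ∏ i ∈ S ∩ T, t i) := by ring
    _ = (∏ i ∈ S ∩ T, (ℓ i : R)) * ∏ i ∈ symmDiff S T, t i := by rw [hsq]; ring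

omit [Fintype ι] in
/-- `S ∩ (S ∆ U) = S ∖ U`. [elementary] -/
theorem inter_symmDiff_eq_sdiff (S U : Finset ι) : S ∩ symmDiff S U = S \ U := by
  ext p; simp only [Finset.mem_inter, Finset.mem_symmDiff, Finset.mem_sdiff]; tauto

/-- **The evaluations are multiplicative for the order product**: with `t_i² = ℓ_i`,
`E_t(z) · E_t(u) = E_t(z ⋆ u)` where `(z ⋆ u)_U = Σ_S z_S u_{S∆U} ℓ_{S∖U}` and `E_t(c) = Σ_S c_S ∏_{i∈S} t_i`.
(Expand, use `prod_root_mul`, and reindex `T ↦ U = S ∆ T`, an involution.) [elementary] -/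
theorem eval_star (ht : ∀ i, t i ^ 2 = (ℓ i : R)) (z u : Finset ι → ℤ) :
    (∑ S : Finset ι, (z S : R) * ∏ i ∈ S, t i) * (∑ T : Finset ι, (u T : R) * ∏ i ∈ T, t i) =
      ∑ U : Finset ι, ((∑ S : Finset ι, z S * u (symmDiff S U) * ∏ i ∈ S \ U, (ℓ i : ℤ) : ℤ) : R) *
        ∏ i ∈ U, t i := by
  rw [Finset.sum_mul_sum]
  -- rewrite each term and reindex the inner sum by the involution `T ↦ S ∆ T`
  have hterm : ∀ S T : Finset ι, ((z S : R) * ∏ i ∈ S, t i) * ((u T : R) * ∏ i ∈ T, t i) =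
      ((z S * u T * ∏ i ∈ S ∩ T, (ℓ i : ℤ) : ℤ) : R) * ∏ i ∈ symmDiff S T, t i := by
    intro S T
    have := prod_root_mul ℓ t ht S T
    push_cast
    calc ((z S : R) * ∏ i ∈ S, t i) * ((u T : R) * ∏ i ∈ T, t i)
        = (z S : R) * (u T : R) * ((∏ i ∈ S, t i) * ∏ i ∈ T, t i) := by ring
      _ = (z S : R) * (u T : R) * ((∏ i ∈ S ∩ T, (ℓ i : R)) * ∏ i ∈ symmDiff S T, t i) := by rw [this]
      _ = (z S : R) * (u T : R) * (∏ i ∈ S ∩ T, (ℓ i : R)) * ∏ i ∈ symmDiff S T, t i := by ring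
  simp_rw [hterm]
  -- inner reindexing
  have hinner : ∀ S : Finset ι,
      ∑ T : Finset ι, ((z S * u T * ∏ i ∈ S ∩ T, (ℓ i : ℤ) : ℤ) : R) * ∏ i ∈ symmDiff S T, t i =
      ∑ U : Finset ι, ((z S * u (symmDiff S U) * ∏ i ∈ S \ U, (ℓ i : ℤ) : ℤ) : R) * ∏ i ∈ U, t i := by
    intro S
    let e : Finset ι ≃ Finset ι :=
      { toFun := fun T => symmDiff S T
        invFun := fun U => symmDiff S U
        left_inv := fun T => symmDiff_symmDiff_cancel_left S T
        right_inv := fun U => symmDiff_symmDiff_cancel_left S U }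
    rw [← e.sum_comp]
    refine Finset.sum_congr rfl fun U _ => ?_
    simp only [e, Equiv.coe_fn_mk, symmDiff_symmDiff_cancel_left, inter_symmDiff_eq_sdiff]
  simp_rw [hinner]
  rw [Finset.sum_comm]
  refine Finset.sum_congr rfl fun U _ => ?_
  rw [← Finset.sum_mul]
  push_cast
  rfl

omit [DecidableEq ι] in
/-- The evaluation map is additive: `E_t(z − z') = E_t(z) − E_t(z')`. [elementary] -/
theorem eval_sub (z z' : Finset ι → ℤ) :
    (∑ S : Finset ι, ((z S - z' S : ℤ) : R) * ∏ i ∈ S, t i) =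
      (∑ S : Finset ι, (z S : R) * ∏ i ∈ S, t i) - ∑ S : Finset ι, (z' S : R) * ∏ i ∈ S, t i := by
  rw [← Finset.sum_sub_distrib]
  refine Finset.sum_congr rfl fun S _ => ?_
  push_cast
  ring

/-- **The trace functional on a square**: `(z ⋆ z)_∅ = Σ_S z_S² ℓ_S`. [elementary] -/
theorem star_self_empty (z : Finset ι → ℤ) :
    (∑ S : Finset ι, z S * z (symmDiff S ∅) * ∏ i ∈ S \ ∅, (ℓ i : ℤ)) =
      ∑ S : Finset ι, z S ^ 2 * ∏ i ∈ S, (ℓ i : ℤ) := by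
  refine Finset.sum_congr rfl fun S _ => ?_
  have h1 : symmDiff S ∅ = S := symmDiff_bot S
  rw [h1, Finset.sdiff_empty, sq]

/-- **Positive definiteness of the trace form, in coordinates**: if all `ℓ_i ≥ 1` and `z ≠ 0` then
`(z ⋆ z)_∅ = Σ_S z_S² ℓ_S > 0` (the multiquadratic case of `Tr_{K/ℚ}(z²) > 0` for totally real `K`).
[Pohoata 2026 Obs. 3.1, elementary here] -/
theorem star_self_empty_pos (hℓ : ∀ i, 1 ≤ ℓ i) {z : Finset ι → ℤ} (hz : z ≠ 0) :
    0 < ∑ S : Finset ι, z S * z (symmDiff S ∅) * ∏ i ∈ S \ ∅, (ℓ i : ℤ) := by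
  rw [star_self_empty]
  obtain ⟨S₀, hS₀⟩ : ∃ S, z S ≠ 0 := by
    by_contra h
    push Not at h
    exact hz (funext h)
  have hpos : ∀ S : Finset ι, 0 < ∏ i ∈ S, (ℓ i : ℤ) := fun S =>
    Finset.prod_pos fun i _ => by exact_mod_cast hℓ i
  have hle : z S₀ ^ 2 * ∏ i ∈ S₀, (ℓ i : ℤ) ≤ ∑ S : Finset ι, z S ^ 2 * ∏ i ∈ S, (ℓ i : ℤ) :=
    Finset.single_le_sum (f := fun S => z S ^ 2 * ∏ i ∈ S, (ℓ i : ℤ))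
      (fun S _ => mul_nonneg (sq_nonneg _) (hpos S).le) (Finset.mem_univ S₀)
  have hlt : 0 < z S₀ ^ 2 * ∏ i ∈ S₀, (ℓ i : ℤ) := mul_pos (by positivity) (hpos S₀)
  exact lt_of_lt_of_le hlt hle

/-- **`z = 0` from `(z ⋆ z)_∅ = 0`** (all `ℓ_i ≥ 1`). [elementary] -/
theorem eq_zero_of_star_self_empty (hℓ : ∀ i, 1 ≤ ℓ i) {z : Finset ι → ℤ}
    (h : (∑ S : Finset ι, z S * z (symmDiff S ∅) * ∏ i ∈ S \ ∅, (ℓ i : ℤ)) = 0) : z = 0 := by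
  by_contra hz
  exact (star_self_empty_pos ℓ hℓ hz).ne' h

/-- **Support**: if `𝒮` is closed under `∆`, `z` and `u` vanish off `𝒮`, and `U ∉ 𝒮`, then `(z ⋆ u)_U = 0`
(each term has `S ∉ 𝒮` or `S ∆ U ∉ 𝒮`). [elementary] -/
theorem star_support {𝒮 : Finset (Finset ι)} (hΔ : ∀ S ∈ 𝒮, ∀ T ∈ 𝒮, symmDiff S T ∈ 𝒮)
    {z u : Finset ι → ℤ} (hz : ∀ S, S ∉ 𝒮 → z S = 0) (hu : ∀ S, S ∉ 𝒮 → u S = 0)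
    {U : Finset ι} (hU : U ∉ 𝒮) :
    (∑ S : Finset ι, z S * u (symmDiff S U) * ∏ i ∈ S \ U, (ℓ i : ℤ)) = 0 := by
  refine Finset.sum_eq_zero fun S _ => ?_
  by_cases hS : S ∈ 𝒮
  · have : symmDiff S U ∉ 𝒮 := by
      intro hSU
      have := hΔ S hS _ hSU
      rw [symmDiff_symmDiff_cancel_left] at this
      exact hU this
    rw [hu _ this]; ring
  · rw [hz _ hS]; ring

/-- The product with the zero vector on the left vanishes. [elementary] -/
theorem zero_star (u : Finset ι → ℤ) (U : Finset ι) :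
    (∑ S : Finset ι, (0 : Finset ι → ℤ) S * u (symmDiff S U) * ∏ i ∈ S \ U, (ℓ i : ℤ)) = 0 := by
  simp

/-- **Coefficient bound for the product**: if `|z_S| ≤ A`, `|u_S| ≤ B` and `ℓ_S ≤ L` for all `S` then
`|(z ⋆ u)_U| ≤ 2^{|ι|} · A · B · L`. [elementary] -/
theorem abs_star_le {z u : Finset ι → ℤ} {A B : ℤ} (hA : ∀ S, |z S| ≤ A) (hB : ∀ S, |u S| ≤ B) {L : ℕ}
    (hL : ∀ S : Finset ι, ∏ i ∈ S, ℓ i ≤ L) (U : Finset ι) :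
    |∑ S : Finset ι, z S * u (symmDiff S U) * ∏ i ∈ S \ U, (ℓ i : ℤ)| ≤ 2 ^ Fintype.card ι * A * B * L := by
  have hA0 : 0 ≤ A := le_trans (abs_nonneg _) (hA ∅)
  have hB0 : 0 ≤ B := le_trans (abs_nonneg _) (hB ∅)
  calc |∑ S : Finset ι, z S * u (symmDiff S U) * ∏ i ∈ S \ U, (ℓ i : ℤ)|
      ≤ ∑ S : Finset ι, |z S * u (symmDiff S U) * ∏ i ∈ S \ U, (ℓ i : ℤ)| := Finset.abs_sum_le_sum_abs _ _
    _ ≤ ∑ _S : Finset ι, A * B * L := by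
        refine Finset.sum_le_sum fun S _ => ?_
        rw [abs_mul, abs_mul]
        have h3 : |∏ i ∈ S \ U, (ℓ i : ℤ)| ≤ L := by
          rw [abs_of_nonneg (Finset.prod_nonneg fun i _ => by positivity)]
          exact_mod_cast hL (S \ U)
        exact mul_le_mul (mul_le_mul (hA S) (hB (symmDiff S U)) (abs_nonneg _) hA0) h3 (abs_nonneg _)
          (mul_nonneg hA0 hB0)
    _ = 2 ^ Fintype.card ι * A * B * L := by
        rw [Finset.sum_const, Finset.card_univ, Fintype.card_finset, nsmul_eq_mul]
        push_cast
        ring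

omit [DecidableEq ι] in
/-- `ℓ_S ≤ L := ∏_i ℓ_i` for every `S` when all `ℓ_i ≥ 1`. [elementary] -/
theorem prod_le_prod_univ (hℓ : ∀ i, 1 ≤ ℓ i) (S : Finset ι) : ∏ i ∈ S, ℓ i ≤ ∏ i, ℓ i :=
  Finset.prod_le_prod_of_subset_of_one_le' (Finset.subset_univ S) fun i _ _ => hℓ i

end Summit.MatrixMultiplication.MatrixMultiplication.Theorems.LevelOneGL2Designs.Multiquadratic
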